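import Literature.Probability.LatticeModels.HighDimTrivialityAssembly
import Literature.Barriers.CriticalPhenomena.IsingTrivialityFromDimensionFour
import HarnessLib

/-!
# High-dimensional triviality of Ising scaling limits, VI: the tree diagram bound from finite graphs

Trunk: StatMech (G02); family `crit-ising` (crit-ising.S13). This file removes the
infinite-volume named fact `aizenman_treeDiagramBound` (`HighDimTrivialityUniform`) from the
trust base of crit-ising.S13 in favour of the tree's pre-existing finite-graph named fact
`Literature.Barriers.CriticalPhenomena.treeDiagramBound` (Aizenman 1982, as printed in Aizenman,
CDM 2020, Lemma 8.1 / (8.2): "for the Ising model on any finite graph, at `h = 0` and `β ≥ 0` …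
`|U₄(x₁,…,x₄)| ≤ 2 Σ_u ⟨σ_uσ_{x₁}⟩⟨σ_uσ_{x₂}⟩⟨σ_uσ_{x₃}⟩⟨σ_uσ_{x₄}⟩`"):

* `isingExpect_free_box_eq` — the free finite-volume Gibbs measure of `Λ ⊆ ℤ^d` is the Ising
  model of the induced graph (`isingExpect_free_map` of `IsingTransport`); the finite-graph bound
  transported to the free state of `Λ` is the tree THEOREM
  `Literature.Probability.LatticeModels.treeDiagramBound_freeFinset` of
  `HighDimTrivialityUniformProofs` (proved there from `treeDiagramBound_holds`; the former
  in-file restatement `treeDiagramBound_finset`, which took the fact as a hypothesis, was removed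
  as its duplicate);
* `treeDiagramBound_dlr_of_treeDiagramBound` — the infinite-volume inequality for every
  `μ ∈ 𝒢(β, 0)`, `0 ≤ β ≤ β_c`, `d ≥ 3`, i.e. the `d ≥ 3` part of `aizenman_treeDiagramBound`,
  in the hypothesis shape granting the finite-graph fact `treeDiagramBound` and the uniqueness /
  free-state facts; now a one-line delegate to the unconditional theorem
  `aizenman_treeDiagramBound_three_le` of `HighDimTrivialityUniformProofs` (signature kept for
  its positional users);
* `ursellFourSum_uniformlySmall_of_treeDiagramBound` and
  `isGaussianProcess_of_tendstoInDistribution_smearedSpin_of_treeDiagramBound` — uniform smallness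
  and **crit-ising.S13 (`Sweep1` form)** with the trust base: `treeDiagramBound` (finite graphs),
  `aizenman_evenMoment_deviation_le`, `newman_evenMoment_le`, `panis_ursellFourSum_le_four`,
  `panis_ursellFourSum_le`, `hasUniqueGibbsMeasure_of_lt_criticalBeta`,
  `hasUniqueGibbsMeasure_criticalBeta`, `exists_freeMeasure`.

## Mathlib

`SimpleGraph.comap` (induced graph on `↥Λ`), `Finset.attach_map_val`, `Filter.Tendsto` algebra,
`le_of_tendsto`. No definitions and no named facts are introduced (the
induced graph on `↥Λ` is written `(zdGraph d).comap (Function.Embedding.subtype (· ∈ Λ))`).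
-/

noncomputable section

open MeasureTheory Filter Topology Finset
open Literature.Probability.LatticeModels Literature.Probability.Percolation

namespace Literature.Probability.LatticeModels

variable {d : ℕ}

section FiniteGraph

/-- `univ.map (subtype embedding) = Λ`. [folklore] -/
theorem univ_map_subtype_eq (Λ : Finset (Site d)) :
    (Finset.univ : Finset ↥Λ).map (Function.Embedding.subtype fun x => x ∈ Λ) = Λ := by
  rw [Finset.univ_eq_attach, Finset.attach_map_val]

/-- **The free finite-volume state of `Λ ⊆ ℤ^d` is the Ising model of the induced finite graph**:
expectations of measurable observables agree after extending configurations by `+1` off `Λ`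
(`isingExpect_free_map` along the subtype embedding). [folklore] -/
theorem isingExpect_free_box_eq (Λ : Finset (Site d)) (β h : ℝ) {f : SpinConfig (Site d) → ℝ}
    (hf : Measurable f) :
    isingExpect (zdGraph d) Λ β h .free f =
      isingExpect ((zdGraph d).comap (Function.Embedding.subtype fun x => x ∈ Λ)) Finset.univ β h .free
        (fun τ => f (SpinConfig.extendAlong (Function.Embedding.subtype fun x => x ∈ Λ) τ)) := by
  have h1 := isingExpect_free_map (G := ((zdGraph d).comap (Function.Embedding.subtype fun x => x ∈ Λ))) (G' := zdGraph d)
    (Function.Embedding.subtype fun x => x ∈ Λ) (Λ := Finset.univ)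
    (fun a _ b _ => Iff.rfl) β h hf
  rw [univ_map_subtype_eq] at h1
  exact h1

end FiniteGraph

section InfiniteVolume

/-- **Spin monomials are set correlations** (any number of sites, repetitions allowed):
`∏ᵢ σ_{xᵢ} = σ_A` with `A` the set of sites occurring an odd number of times (`σ_x² = 1`;
Friedli–Velenik 2017, §3.6.1). [cite: FriedliVelenik2017, §3.6.1] -/
theorem exists_prod_spinAt_eq_spinProduct' {V : Type*} [DecidableEq V] {n : ℕ} (x : Fin n → V) :
    ∃ A : Finset V, ∀ σ : SpinConfig V, ∏ i, spinAt (x i) σ = spinProduct A σ := by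
  classical
  set S : Finset V := Finset.univ.image x with hS
  set c : V → ℕ := fun b => (Finset.univ.filter fun i : Fin n => x i = b).card with hc
  refine ⟨S.filter fun b => Odd (c b), fun σ => ?_⟩
  rw [spinProduct, Finset.prod_filter,
    Finset.prod_comp (s := (Finset.univ : Finset (Fin n))) (fun b => spinAt b σ) x]
  exact Finset.prod_congr rfl fun b _ => spinAt_pow_eq_ite b σ _

/-- **Thermodynamic limit of spin monomials in the free state**: for the free DLR state `μ`
(correlations `freeCorr`), `⟨∏ᵢ σ_{xᵢ}⟩^∅_{Λ_L;β,0} → ∫ ∏ᵢ σ_{xᵢ} dμ` as `L → ∞`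
(box limits `hasBoxLimit_isingCorr_free_holds`, a theorem of the tree; Friedli–Velenik 2017,
Exercise 3.16). [cite: FriedliVelenik2017, Exercise 3.16] -/
theorem tendsto_isingExpect_prod_spinAt {β : ℝ} (hβ : 0 ≤ β) {μ : Measure (SpinConfig (Site d))}
    (hcorr : ∀ A : Finset (Site d), spinCorr μ A = freeCorr d β 0 A) {n : ℕ}
    (x : Fin n → Site d) :
    Tendsto (fun L : ℕ => ∫ σ, ∏ i, spinAt (x i) σ ∂isingMeasure (zdGraph d) (box d L) β 0 .free)
      atTop (𝓝 (∫ σ, ∏ i, spinAt (x i) σ ∂μ)) := by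
  classical
  obtain ⟨A, hA⟩ := exists_prod_spinAt_eq_spinProduct' x
  simp_rw [hA]
  have h1 : (∫ σ, spinProduct A σ ∂μ) = freeCorr d β 0 A := hcorr A
  rw [h1]
  exact hasBoxLimit_isingCorr_free_holds (d := d) hβ le_rfl A

/-- **Aizenman's tree diagram bound for the DLR states `μ ∈ 𝒢(β, 0)`, `β ≤ β_c`, `d ≥ 3`,
in the hypothesis shape of the finite-graph named fact**
`Literature.Barriers.CriticalPhenomena.treeDiagramBound` and of the uniqueness / free-state
facts (`hU₁`, `hU₂`, `hF`). All four hypotheses are now theorems of the tree, and the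
conclusion is proved unconditionally as `aizenman_treeDiagramBound_three_le`
(`HighDimTrivialityUniformProofs.lean`: uniqueness of `𝒢(β, 0)` for `β ≤ β_c`,
Lebowitz–Martin-Löf below `β_c` and Aizenman–Duminil-Copin–Sidoravicius at `β_c`, then the
box-limit / volume-monotonicity computation `abs_connectedFour_le_treeSum_of_hasUniqueGibbsMeasure`).
This declaration therefore keeps only its SIGNATURE (consumed positionally by
`treeDiagramBound_dlr_three` below and by `HighDimTrivialityCorrLengthWindow`,
`HighDimTrivialityPanisFourProofs`) and delegates the proof; the hypotheses are unused
(dedup-00574: the former 80-line proof duplicated that computation).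
(Aizenman 1982; ADC 2021 §1.3 (tree)). [cite: AizenmanCDM2020, Lemma 8.1 and eq. (8.2)] [cite: AizenmanDuminilCopinAnnals2021, arXiv:1912.07973 §1.3, display (tree) (p. 6)] -/
theorem treeDiagramBound_dlr_of_treeDiagramBound
    (_hTB : Literature.Barriers.CriticalPhenomena.treeDiagramBound)
    (_hU₁ : ∀ {d : ℕ} {β : ℝ}, hasUniqueGibbsMeasure_of_lt_criticalBeta (d := d) (β := β))
    (_hU₂ : ∀ {d : ℕ}, hasUniqueGibbsMeasure_criticalBeta (d := d))
    (_hF : ∀ (d : ℕ) {β : ℝ}, exists_freeMeasure d (β := β) 0)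
    {d : ℕ} (hd : 3 ≤ d) (β : ℝ) (hβ : 0 ≤ β) (hβc : β ≤ criticalBeta d)
    (μ : Measure (SpinConfig (Site d))) (hμ : μ ∈ isingGibbsMeasures d β 0)
    (x : Fin 4 → Site d)
    (hsum : Summable fun u : Site d => ∏ i, ∫ σ, spinAt (x i) σ * spinAt u σ ∂μ) :
    |connectedFour μ spinAt x| ≤ 2 * ∑' u : Site d, ∏ i, ∫ σ, spinAt (x i) σ * spinAt u σ ∂μ :=
  aizenman_treeDiagramBound_three_le hd β hβ hβc μ hμ x hsum

end InfiniteVolume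


section Corollaries

/-- The `d ≥ 3` tree diagram bound for DLR states, in the hypothesis shape of
`ursellFourSum_uniformlySmall_of_facts'`, from the finite-graph named fact. [cite: AizenmanCDM2020, Lemma 8.1 and eq. (8.2)] -/
theorem treeDiagramBound_dlr_three (hTB : Literature.Barriers.CriticalPhenomena.treeDiagramBound)
    (hU₁ : ∀ {d : ℕ} {β : ℝ}, hasUniqueGibbsMeasure_of_lt_criticalBeta (d := d) (β := β))
    (hU₂ : ∀ {d : ℕ}, hasUniqueGibbsMeasure_criticalBeta (d := d))
    (hF : ∀ (d : ℕ) {β : ℝ}, exists_freeMeasure d (β := β) 0) :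
    ∀ {d : ℕ}, 3 ≤ d → ∀ β : ℝ, 0 ≤ β → β ≤ criticalBeta d →
      ∀ μ ∈ isingGibbsMeasures d β 0, ∀ x : Fin 4 → Site d,
        Summable (fun u : Site d => ∏ i, ∫ σ, spinAt (x i) σ * spinAt u σ ∂μ) →
        |connectedFour μ spinAt x| ≤
          2 * ∑' u : Site d, ∏ i, ∫ σ, spinAt (x i) σ * spinAt u σ ∂μ :=
  fun hd β hβ hβc μ hμ x hsum =>
    treeDiagramBound_dlr_of_treeDiagramBound hTB hU₁ hU₂ hF hd β hβ hβc μ hμ x hsum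

/-- **Uniform smallness of `S(μ; L, r)` with the finite-graph tree diagram bound in the trust
base** (`ursellFourSum_uniformlySmall_of_facts'` fed with `treeDiagramBound_dlr_three`): for
`d ≥ 4`, `r ≥ 1`, `ε > 0` there is `L₀` with `Σ_L⁻² ∑_{x ∈ Λ_{rL}⁴} |U₄^μ(x)| ≤ ε` for all
`L ≥ L₀`, `β ∈ [0, β_c]`, `μ ∈ 𝒢(β, 0)` (a derived statement, printed by no source; the regimes
combined are those of Panis 2023, §1.2.1). [cite: Panis2023Triviality, Cor. 1.8, Thm. 5.5, §1.2.1 fn. 2] -/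
theorem ursellFourSum_uniformlySmall_of_treeDiagramBound
    (hTB : Literature.Barriers.CriticalPhenomena.treeDiagramBound)
    (hP4 : panis_ursellFourSum_le_four) (hP5 : panis_ursellFourSum_le)
    (hU₁ : ∀ {d : ℕ} {β : ℝ}, hasUniqueGibbsMeasure_of_lt_criticalBeta (d := d) (β := β))
    (hU₂ : ∀ {d : ℕ}, hasUniqueGibbsMeasure_criticalBeta (d := d))
    (hF : ∀ (d : ℕ) {β : ℝ}, exists_freeMeasure d (β := β) 0) :
    ∀ {d : ℕ}, 4 ≤ d → ∀ r : ℝ, 1 ≤ r → ∀ ε : ℝ, 0 < ε → ∃ L₀ : ℝ,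
      ∀ (β L : ℝ), 0 ≤ β → β ≤ criticalBeta d → L₀ ≤ L →
      ∀ μ ∈ isingGibbsMeasures d β 0, ursellFourSum μ L r ≤ ε :=
  ursellFourSum_uniformlySmall_of_facts' (treeDiagramBound_dlr_three hTB hU₁ hU₂ hF) hP4 hP5
    hU₁ hU₂ hF

universe u in
/-- **crit-ising.S13 (`isGaussianProcess_of_tendstoInDistribution_smearedSpin` of `Sweep1`, the
original statement) with the finite-graph tree diagram bound in the trust base.** The eight
named facts without proof are: `Literature.Barriers.CriticalPhenomena.treeDiagramBound`
(Aizenman 1982, finite graphs), `aizenman_evenMoment_deviation_le`, `newman_evenMoment_le`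
(Aizenman 1982 / ADC 2021 §6.3; reduced to the pointwise inequality in `HighDimTrivialityWick`),
`panis_ursellFourSum_le_four` (Panis 2023 Cor. 1.8), `panis_ursellFourSum_le` (Panis 2023
Thm 5.5), `hasUniqueGibbsMeasure_of_lt_criticalBeta`, `hasUniqueGibbsMeasure_criticalBeta`,
`exists_freeMeasure`; everything else (flip symmetry, variance bounds, modified Simon–Lieb,
GKS, box limits, infrared bound, and the probabilistic assembly) is proved in the tree. [cite: AizenmanDuminilCopinAnnals2021, arXiv:1912.07973 Thm 1.2, Prop. 1.4 and §6.3] [cite: Panis2023Triviality, Thm. 1.2, Cor. 1.8, Thm. 5.5 and §1.2.1 fn. 2] -/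
theorem isGaussianProcess_of_tendstoInDistribution_smearedSpin_of_treeDiagramBound
    (hM₁ : aizenman_evenMoment_deviation_le) (hM₂ : newman_evenMoment_le)
    (hTB : Literature.Barriers.CriticalPhenomena.treeDiagramBound)
    (hP₄ : panis_ursellFourSum_le_four) (hP₅ : panis_ursellFourSum_le)
    (hU₁ : ∀ {d : ℕ} {β : ℝ}, hasUniqueGibbsMeasure_of_lt_criticalBeta (d := d) (β := β))
    (hU₂ : ∀ {d : ℕ}, hasUniqueGibbsMeasure_criticalBeta (d := d))
    (hF : ∀ (d : ℕ) {β : ℝ}, exists_freeMeasure d (β := β) 0) :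
    isGaussianProcess_of_tendstoInDistribution_smearedSpin.{u} :=
  isGaussianProcess_of_tendstoInDistribution_smearedSpin_of_uniformlySmall hM₁ hM₂
    (oddSpinCorrelation_eq_zero_of_facts hU₁ hU₂ hF fun d => isingCorr_free_of_odd_card_holds (zdGraph d))
    (normalizedField_variance_bounds_of_facts hU₁ hU₂ hF)
    (ursellFourSum_uniformlySmall_of_treeDiagramBound hTB hP₄ hP₅ hU₁ hU₂ hF)

end Corollaries

end Literature.Probability.LatticeModels
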